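import Summits.ResolutionOfSingularities.KangarooAtlas.MizutaniDigitLemma
import HarnessLib

/-!
# The digit split behind Mizutani's Lemma 2.4: `N = T + M`, `T ≤_p N` digitwise, `|T| ≤ q − 1`, `|M| ≤ pq − q`

Cell `pub-rosobs`, Mizutani enclosure (seat mizutani-encloser-1, gen 9).  AI-written; *AI review is weaker than
expert review*; NOT a resolution-of-singularities theorem (summit relevance C).

Mizutani 1973, proof of Lemma 2.4 («the operators `D = ∏ D_{ij}^{t_{ij}}` … can be written as `D'D''` with `D' ∈ Diff_{q−q'}`,
`D'' ∈ Diff_{q'−1}(K/k^{q'})`»): in base `p` this is a split of multi-indices.  With `q = p^e` and the base-`p` digit tools of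
`MizutaniDigitLemma.lean` (`digit`, `DigitLE`): `exists_subcount` (for unit counts `c_j` of sizes `p^j`, `j < e`, with total `S` and
`m q + S mod q ≤ S`, a sub-count with value in `[m q + S mod q, m q + q − 1]`, induction on `e`), `exists_le_sum_eq` (distributing a
total among coordinates), and **`exists_digit_split`**: for `N : Fin s → ℕ` with `N_i < p^{e+1}` there is `T` with `T_i ≤_p N_i`
digitwise, `T_i < q`, `Σ T_i ≤ q − 1`, `(Σ N_i) mod q ≤ Σ T_i`; **`exists_digit_split'`**: if moreover `Σ N_i ≤ pq − 1` then
`Σ (N_i − T_i) ≤ pq − q`.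

References: H. Mizutani, Nagoya Math. J. 52 (1973), Lemma 2.4 (proof) [Mizutani1973HironakaGroupSchemes].
-/

open Finset

namespace Summit.ResolutionOfSingularities.KangarooAtlas.Mizutani.DigitLemma

variable {p : ℕ}

/-- A number with `e` digits `< p` is `< p^e`. [folklore] -/
theorem sum_digits_lt (_hp : 2 ≤ p) : ∀ (e : ℕ) (t : ℕ → ℕ), (∀ l, t l < p) → ∑ k ∈ range e, t k * p ^ k < p ^ e := by
  intro e
  induction e with
  | zero => intro t _; simp
  | succ e ih =>
    intro t ht
    rw [sum_range_succ, pow_succ]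
    have h1 := ih t ht
    have h2 : t e * p ^ e + p ^ e ≤ p ^ e * p := by
      have h3 : (t e + 1) * p ^ e ≤ p * p ^ e := Nat.mul_le_mul_right _ (ht e)
      calc t e * p ^ e + p ^ e = (t e + 1) * p ^ e := by ring
        _ ≤ p * p ^ e := h3
        _ = p ^ e * p := mul_comm _ _
    omega

/-- The low digits of `n` are the digits of `n mod p^e`. [folklore] -/
theorem digit_mod_pow_of_lt (hp : 2 ≤ p) {e j : ℕ} (hj : j < e) (n : ℕ) : digit p (n % p ^ e) j = digit p n j := by
  have hpos : 0 < p := by omega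
  obtain ⟨d, hd⟩ : ∃ d, e = j + (d + 1) := ⟨e - j - 1, by omega⟩
  subst hd
  unfold digit
  conv_rhs => rw [← Nat.mod_add_div n (p ^ (j + (d + 1)))]
  rw [show p ^ (j + (d + 1)) * (n / p ^ (j + (d + 1))) = p ^ j * (p ^ d * (n / p ^ (j + (d + 1))) * p) by ring,
    Nat.add_mul_div_left _ _ (pow_pos hpos j), Nat.add_mul_mod_self_right]

/-- **Sub-counts with prescribed value window.**  For unit counts `c_j` (units of size `p^j`, `j < e`) with total
`S = Σ_{j<e} c_j p^j` and every `m` with `m p^e + S mod p^e ≤ S`, there is `x ≤ c` with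
`m p^e + S mod p^e ≤ Σ_{j<e} x_j p^j ≤ m p^e + p^e − 1`. [cite: Mizutani1973HironakaGroupSchemes, Lemma 2.4 (proof)] -/
theorem exists_subcount (hp : 2 ≤ p) : ∀ (e : ℕ) (c : ℕ → ℕ) (m : ℕ),
    m * p ^ e + (∑ j ∈ range e, c j * p ^ j) % p ^ e ≤ ∑ j ∈ range e, c j * p ^ j →
    ∃ x : ℕ → ℕ, (∀ j, x j ≤ c j) ∧
      m * p ^ e + (∑ j ∈ range e, c j * p ^ j) % p ^ e ≤ ∑ j ∈ range e, x j * p ^ j ∧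
      ∑ j ∈ range e, x j * p ^ j + 1 ≤ m * p ^ e + p ^ e := by
  intro e
  induction e with
  | zero =>
    intro c m hm
    simp only [range_zero, sum_empty, pow_zero, mul_one, Nat.mod_one, add_zero, nonpos_iff_eq_zero] at hm
    subst hm
    exact ⟨fun _ => 0, fun _ => Nat.zero_le _, by simp, by simp⟩
  | succ e ih =>
    intro c m hm
    have hpos : 0 < p := by omega
    set q' := p ^ e with hq'
    have hq'pos : 0 < q' := pow_pos hpos e
    set S' := ∑ j ∈ range e, c j * p ^ j with hS'
    have hS : ∑ j ∈ range (e + 1), c j * p ^ j = c e * q' + S' := by rw [sum_range_succ, add_comm]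
    set A := c e + S' / q' with hA
    set r' := S' % q' with hr'
    have hr'lt : r' < q' := Nat.mod_lt _ hq'pos
    have hS'eq : S' = S' / q' * q' + r' := (Nat.div_add_mod' S' q').symm
    have hAp : A = A / p * p + A % p := (Nat.div_add_mod' A p).symm
    have hmodp : A % p + 1 ≤ p := Nat.mod_lt A hpos
    -- `S = (A / p)·(p q') + rest` with `rest = (A % p) q' + r' < p q'`
    have hrest_lt : A % p * q' + r' < p * q' := by
      have : (A % p + 1) * q' ≤ p * q' := Nat.mul_le_mul_right _ hmodp
      nlinarith
    have hSdecomp : c e * q' + S' = A / p * (p * q') + (A % p * q' + r') := by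
      have : c e * q' + S' = A * q' + r' := by rw [hA, add_mul, add_assoc, ← hS'eq]
      rw [this]
      conv_lhs => rw [hAp]
      ring
    have hQ : p ^ (e + 1) = p * q' := by rw [pow_succ, mul_comm]
    have hmodQ : (c e * q' + S') % (p * q') = A % p * q' + r' := by
      rw [hSdecomp, mul_comm (A / p) (p * q'), Nat.mul_add_mod, Nat.mod_eq_of_lt hrest_lt]
    rw [hS, hQ, hmodQ] at hm ⊢
    -- `m ≤ A / p`, hence `m p + A % p ≤ A = c_e + S'/q'`
    have hm1 : m * (p * q') ≤ A / p * (p * q') := by rw [hSdecomp] at hm; exact Nat.le_of_add_le_add_right hm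
    have hm2 : m ≤ A / p := Nat.le_of_mul_le_mul_right hm1 (Nat.mul_pos hpos hq'pos)
    have hm3 : m * p + A % p ≤ c e + S' / q' := by
      rw [← hA]
      calc m * p + A % p ≤ A / p * p + A % p := by nlinarith
        _ = A := hAp.symm
    -- take `y` top units and delegate the rest to the lower positions
    set y := min (c e) (m * p + A % p) with hy
    have hy1 : y ≤ c e := min_le_left _ _
    have hy2 : y ≤ m * p + A % p := min_le_right _ _
    obtain ⟨m'', hm''⟩ := Nat.exists_eq_add_of_le hy2
    have hm''le : m'' ≤ S' / q' := by
      rcases le_total (c e) (m * p + A % p) with hle | hle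
      · have hy' : y = c e := min_eq_left hle
        have h' := hm''
        rw [hy'] at h'
        have : c e + m'' ≤ c e + S' / q' := h' ▸ hm3
        exact Nat.le_of_add_le_add_left this
      · have hy' : y = m * p + A % p := min_eq_right hle
        have h' := hm''
        rw [hy'] at h'
        have : m * p + A % p + m'' = m * p + A % p + 0 := by rw [← h', add_zero]
        rw [Nat.add_left_cancel this]
        exact Nat.zero_le _
    have hIH : m'' * q' + S' % q' ≤ S' :=
      calc m'' * q' + S' % q' ≤ S' / q' * q' + S' % q' := Nat.add_le_add_right (Nat.mul_le_mul_right _ hm''le) _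
        _ = S' := Nat.div_add_mod' S' q'
    obtain ⟨x', hx'c, hlo, hhi⟩ := ih c m'' hIH
    rw [← hr'] at hlo
    have hxe : Function.update x' e y e = y := Function.update_self ..
    have hsum : ∑ j ∈ range e, Function.update x' e y j * p ^ j = ∑ j ∈ range e, x' j * p ^ j :=
      sum_congr rfl fun j hj => by rw [Function.update_of_ne (by have := mem_range.mp hj; omega)]
    refine ⟨Function.update x' e y, fun j => ?_, ?_, ?_⟩
    · by_cases hj : j = e
      · subst hj; rw [hxe]; exact hy1
      · rw [Function.update_of_ne hj]; exact hx'c j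
    · -- lower bound
      rw [sum_range_succ, hxe, hsum]
      have key : m * (p * q') + (A % p * q' + r') = (m'' * q' + r') + y * q' := by
        calc m * (p * q') + (A % p * q' + r') = (m * p + A % p) * q' + r' := by ring
          _ = (y + m'') * q' + r' := by rw [hm'']
          _ = (m'' * q' + r') + y * q' := by ring
      rw [key]
      exact Nat.add_le_add_right hlo _
    · -- upper bound
      rw [sum_range_succ, hxe, hsum]
      have h1 : ∑ j ∈ range e, x' j * p ^ j + y * q' + 1 ≤ (m'' + y) * q' + q' := by
        calc ∑ j ∈ range e, x' j * p ^ j + y * q' + 1 = (∑ j ∈ range e, x' j * p ^ j + 1) + y * q' := by ring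
          _ ≤ (m'' * q' + q') + y * q' := Nat.add_le_add_right hhi _
          _ = (m'' + y) * q' + q' := by ring
      have h2 : (m'' + y) * q' + q' ≤ m * (p * q') + p * q' := by
        rw [add_comm m'' y, ← hm'']
        have : (A % p + 1) * q' ≤ p * q' := Nat.mul_le_mul_right _ hmodp
        nlinarith
      exact le_trans h1 h2

/-- **Distributing a total among bounded slots**: if `x ≤ Σ_i d_i` then `x = Σ_i t_i` with `t ≤ d`. [folklore] -/
theorem exists_le_sum_eq : ∀ {s : ℕ} (d : Fin s → ℕ) (x : ℕ), x ≤ ∑ i, d i →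
    ∃ t : Fin s → ℕ, (∀ i, t i ≤ d i) ∧ ∑ i, t i = x
  | 0, d, x, hx => by
    refine ⟨fun _ => 0, fun _ => Nat.zero_le _, ?_⟩
    simp only [univ_eq_empty, sum_empty] at hx ⊢
    omega
  | s + 1, d, x, hx => by
    rw [Fin.sum_univ_succ] at hx
    by_cases h : x ≤ d 0
    · refine ⟨Fin.cons x fun _ => 0, fun i => ?_, ?_⟩
      · refine Fin.cases ?_ (fun j => ?_) i
        · simpa using h
        · simp
      · rw [Fin.sum_univ_succ]; simp
    · push Not at h
      obtain ⟨t', ht'd, ht'sum⟩ := exists_le_sum_eq (fun j => d j.succ) (x - d 0) (by omega)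
      refine ⟨Fin.cons (d 0) t', fun i => ?_, ?_⟩
      · refine Fin.cases ?_ (fun j => ?_) i
        · simp
        · simpa using ht'd j
      · rw [Fin.sum_univ_succ]
        simp only [Fin.cons_zero, Fin.cons_succ]
        rw [ht'sum]
        omega

/-- **THE DIGIT SPLIT.**  For `N : Fin s → ℕ` with `N_i < p^{e+1}` there is `T : Fin s → ℕ` with `T_i ≤_p N_i` digitwise (so
`C(N_i, T_i) ≢ 0 mod p` by Lucas), `T_i < p^e`, `Σ T_i ≤ p^e − 1` and `(Σ N_i) mod p^e ≤ Σ T_i`.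
[cite: Mizutani1973HironakaGroupSchemes, Lemma 2.4 (proof)] -/
theorem exists_digit_split (hp : 2 ≤ p) (e : ℕ) {s : ℕ} (N : Fin s → ℕ) :
    ∃ T : Fin s → ℕ, (∀ i, DigitLE p (T i) (N i)) ∧ (∀ i, T i < p ^ e) ∧
      ∑ i, T i + 1 ≤ p ^ e ∧ (∑ i, N i) % p ^ e ≤ ∑ i, T i := by
  have hpos : 0 < p := by omega
  -- unit counts of the low digits
  set c : ℕ → ℕ := fun j => ∑ i, digit p (N i) j with hc
  set S : ℕ := ∑ j ∈ range e, c j * p ^ j with hS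
  -- `S = Σ_i (N_i mod p^e)`, so `S ≡ Σ N_i (mod p^e)`
  have hSeq : S = ∑ i, N i % p ^ e := by
    rw [hS]
    simp_rw [hc, sum_mul]
    rw [sum_comm]
    refine sum_congr rfl fun i _ => ?_
    rw [← expand hp e (N i % p ^ e) (Nat.mod_lt _ (pow_pos hpos e))]
    exact sum_congr rfl fun j hj => by rw [digit_mod_pow_of_lt hp (mem_range.mp hj)]
  have hSmod : S % p ^ e = (∑ i, N i) % p ^ e := by
    rw [hSeq]; exact (Finset.sum_nat_mod _ _ _).symm
  obtain ⟨x, hxc, hlo, hhi⟩ := exists_subcount hp e c 0 (by rw [zero_mul, zero_add]; exact Nat.mod_le _ _)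
  rw [zero_mul, zero_add] at hlo hhi
  -- distribute `x_j` among the coordinates, below the digits
  have hdist : ∀ j, ∃ t : Fin s → ℕ, (∀ i, t i ≤ digit p (N i) j) ∧ ∑ i, t i = x j :=
    fun j => exists_le_sum_eq (fun i => digit p (N i) j) (x j) (hxc j)
  choose t htle htsum using hdist
  refine ⟨fun i => ∑ j ∈ range e, t j i * p ^ j, fun i => ?_, fun i => ?_, ?_, ?_⟩
  · -- digitwise domination
    intro l
    rw [digit_ofDigits hp e (fun j => t j i) (fun j => lt_of_le_of_lt (htle j i) (digit_lt hpos _ _))]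
    split_ifs with hl
    · exact htle l i
    · exact Nat.zero_le _
  · exact sum_digits_lt hp e (fun j => t j i) (fun j => lt_of_le_of_lt (htle j i) (digit_lt hpos _ _))
  · have : ∑ i, ∑ j ∈ range e, t j i * p ^ j = ∑ j ∈ range e, x j * p ^ j := by
      rw [sum_comm]
      exact sum_congr rfl fun j _ => by rw [← sum_mul, htsum]
    rw [this]; exact hhi
  · have : ∑ i, ∑ j ∈ range e, t j i * p ^ j = ∑ j ∈ range e, x j * p ^ j := by
      rw [sum_comm]
      exact sum_congr rfl fun j _ => by rw [← sum_mul, htsum]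
    rw [this, ← hSmod]; exact hlo

/-- The split with the bound on the complementary part: if moreover `Σ N_i ≤ p·p^e − 1` then `Σ (N_i − T_i) ≤ p·p^e − p^e`
(`= (p−1) p^e`). [cite: Mizutani1973HironakaGroupSchemes, Lemma 2.4 (proof)] -/
theorem exists_digit_split' (hp : 2 ≤ p) (e : ℕ) {s : ℕ} (N : Fin s → ℕ) (hsum : ∑ i, N i + 1 ≤ p * p ^ e) :
    ∃ T : Fin s → ℕ, (∀ i, DigitLE p (T i) (N i)) ∧ (∀ i, T i ≤ N i) ∧ (∀ i, T i < p ^ e) ∧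
      ∑ i, T i + 1 ≤ p ^ e ∧ ∑ i, (N i - T i) + p ^ e ≤ p * p ^ e := by
  obtain ⟨T, hdig, hlt, hle, hmod⟩ := exists_digit_split hp e N
  have hTN : ∀ i, T i ≤ N i := fun i => le_of_digitLE hp (hdig i)
  refine ⟨T, hdig, hTN, hlt, hle, ?_⟩
  have hq : 0 < p ^ e := pow_pos (by omega) e
  have hsub : ∑ i, (N i - T i) + ∑ i, T i = ∑ i, N i := by
    rw [← sum_add_distrib]; exact sum_congr rfl fun i _ => Nat.sub_add_cancel (hTN i)
  -- `Σ N − Σ T ≤ Σ N − (Σ N mod q) = q · (Σ N / q) ≤ q (p − 1)`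
  have hdm := Nat.div_add_mod (∑ i, N i) (p ^ e)
  have hdiv : (∑ i, N i) / p ^ e + 1 ≤ p :=
    (Nat.div_lt_iff_lt_mul hq).mpr (by omega)
  have h2 : p ^ e * ((∑ i, N i) / p ^ e) + p ^ e ≤ p * p ^ e := by
    have := Nat.mul_le_mul_left (p ^ e) hdiv
    rw [mul_add, mul_one, mul_comm (p ^ e) p] at this
    exact this
  have h1 : ∑ i, (N i - T i) ≤ p ^ e * ((∑ i, N i) / p ^ e) := by
    have h3 : ∑ i, (N i - T i) + ∑ i, T i ≤ p ^ e * ((∑ i, N i) / p ^ e) + ∑ i, T i := by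
      rw [hsub]
      calc ∑ i, N i = p ^ e * ((∑ i, N i) / p ^ e) + (∑ i, N i) % p ^ e := hdm.symm
        _ ≤ p ^ e * ((∑ i, N i) / p ^ e) + ∑ i, T i := Nat.add_le_add_left hmod _
    exact Nat.le_of_add_le_add_right h3
  calc ∑ i, (N i - T i) + p ^ e ≤ p ^ e * ((∑ i, N i) / p ^ e) + p ^ e := Nat.add_le_add_right h1 _
    _ ≤ p * p ^ e := h2

end Summit.ResolutionOfSingularities.KangarooAtlas.Mizutani.DigitLemma
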